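import Summits.CriticalPhenomena.PercolationContinuityZ3.Theorems.Transplant.SkelSign1Params
import HarnessLib

/-!
# D″ L7′ params, part 5c: **`PlanarSkeletonSign.signChoice₂`** — THE CHOICE FUNCTION OF RECORD of the single-type D″ node: `signChoice₀` (p253201)
# with TWO values corrected, everything else verbatim:
# (1) the UNIT FLOOR is `n₀ + ρz` (`ρz = ψ M_u + off`), so that both planar units satisfy `e_i ≥ ψ(D.k) + off`: the (F) first hop
#     (hp-8 g30, `Skelφ.faceOblR_concS_kits`, binder `hkR : ψ(D.k) + off ≤ D.R (amax a₁)` with `a₁ = widths (ℓ1)`, `ℓ1 ≥ e`) needs the WIRED SEED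
#     `fatSeqOff off c D.k` (graph radius `ψ(D.k) + off`) inside the first rectangle's fat prism (radius `ψ(amax a₁) ≥ amax a₁ ≥ ℓ1`); the Step-I′
#     offset `off` is independent of `ψ` and of every planar quantity, so no floor free of `off` can give it — and `TwoUnitL D` grants ANY floor;
# (2) the fibre block's `ψM` slot is the SEED DEPTH `ψMz := max (ψ M) ρz` (as in `signChoice₁`, p253985), so that `L_A ∋ Rex q (2·ψMz)` covers the
#     inner routes' entrances as deep as the wired seed.
# The values live in the namespace `PlanarSkeletonSign.Sgn₂` under the SAME short names as `Sgn.*` (`n₀ e cells ℓ1 emin emax ℓ₀ ℓtop sS sL sC Smin Smax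
# Sx Sy Rex topScale ψMz schedIn Λ choiceAt`); the unit-free values (`K a A L δkit δI m₀ Mu ρz M T₀ Kd Rseed rs cU sB B kP NP Lcnt Rlev R' η reachK Sz`)
# are `Sgn`'s own and are not duplicated.  The residue wrappers target `signChoice₂`: `rootHoldsFn_signChoice₂` (p2), `faceHoldsRFn_signChoice₂` (hp-8),
# `reachHoldsRHFn_signChoice₂` (p5); the (Z″) closure reads `samePDropOfSkeletonSign₁_of_choiceFnRH signChoice₂ wfHoldsFn_signChoice₂ …`.

builds on p205010 (kernel theorem, internal audit signed; external expert review pending) — nothing in this file uses p205010.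
Status sentence (coordinator 2026-08-20T04:30Z): "θ(p_c) = 0 on ℤ^d, all d ≥ 2 — kernel-verified (Lean 4/Mathlib, standard axioms); internal adversarial
audit SIGNED 2026-08-20 04:29Z; external expert review pending."
Lane `prim-bschramm-*`, seat `prim-bschramm-stmt` (gen 9); helper file (`--supports stmt-CriticalPhenomena-4575`).  Ledger: HOME/prim-bschramm-stmt/SIGN-PARAMS.md §5.
[cite: KozmaNitzan2024, §4 Theorem 6 (pp. 25–31): the order of constants ("each scale large compared to all previous ones"); Lemma 12 (p. 24)]
-/

noncomputable section

open MeasureTheory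
open scoped Classical

namespace Summit.CriticalPhenomena.PercolationContinuityZ3.Theorems.Transplant

namespace PlanarSkeletonSign

namespace Sgn₂

open Literature.Probability.Percolation Literature.Probability.LatticeModels SimpleGraph
open SkelConc (Consts)
open BoxProdZ2 (ConcRadiiG Kof twenty_le_Kof le_Kof)
open Sgn (K a A L twenty_le_K one_le_a hundred_le_A five_le_L sixteen_L_le_A δkit δI m₀ Mu ρz M T₀ Rseed rs Rlev R' η reachK Sz L_hyps)

section OLevel

variable (κ : Consts) {V : Type} [DecidableEq V] [Countable V] {G : SimpleGraph V} [G.LocallyFinite] (Φ : PlanarSkeletonSign G)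
  (p : unitInterval) (O : Skelφ.StepI.Out V)

/-! ## §1 The corrected unit floor and everything read off the units -/

/-- **The unit floor, corrected**: `n₀ := Sgn.n₀ + ρz = M_u + R′ + 1 + 40·A·R′ + (ψ M_u + off)`. [this work] -/
def n₀ : ℕ := Sgn.n₀ κ Φ p O + ρz O

/-- **The units** `e 0 = eₓ`, `e 1 = e_y` read off `TwoUnitL D` at `(c := 8, A, L, n₀)`. [this work] -/
def e : Fin 2 → ℕ := Skelφ.Prm.eOf O.D 8 (A κ) (L κ) (n₀ κ Φ p O)

/-- **The two-unit cells** `⟨K, a·e⟩` (`r_i = A·e_i`). [this work] -/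
def cells : PCells2 := Skelφ.Prm.cells (K κ) (a κ) (twenty_le_Kof κ.K₀) (e κ Φ p O)

/-- The first-hop extent `ℓ1_i := M_u + e_i + 2R′ + 1`. [this work] -/
def ℓ1 (i : Fin 2) : ℕ := Mu O + e κ Φ p O i + 2 * R' κ Φ p O + 1

/-- The smaller unit `emin := min e₀ e₁`. [this work] -/
def emin : ℕ := min (e κ Φ p O 0) (e κ Φ p O 1)

/-- The larger unit `emax := max e₀ e₁`. [this work] -/
def emax : ℕ := max (e κ Φ p O 0) (e κ Φ p O 1)

/-- The least route extent `ℓ₀_i := e_i − R′`. [this work] -/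
def ℓ₀ (i : Fin 2) : ℕ := e κ Φ p O i - R' κ Φ p O

/-- The largest certified route extent `ℓtop_i := L·e_i`. [this work] -/
def ℓtop (i : Fin 2) : ℕ := L κ * e κ Φ p O i

/-- The SHORT stride `sS_i := e_i`. [this work] -/
def sS (i : Fin 2) : ℕ := e κ Φ p O i

/-- The LONG stride of a band started from a line segment (`q = 0`): `sL_i := L·e_i − R′`. [this work] -/
def sL (i : Fin 2) : ℕ := L κ * e κ Φ p O i - R' κ Φ p O

/-- The LONG stride of the (C) corridor band started from the Loc core (`q = ℓ₀_i`): `sC_i := (L − 2)·e_i + R′`. [this work] -/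
def sC (i : Fin 2) : ℕ := (L κ - 2) * e κ Φ p O i + R' κ Φ p O

/-- The bottom of the merged certified extent range `Smin := emin − R′`. [this work] -/
def Smin : ℕ := emin κ Φ p O - R' κ Φ p O

/-- The top of the merged range `Smax := L·emax`. [this work] -/
def Smax : ℕ := L κ * emax κ Φ p O

/-- The `x`-extent list `{M_u+1, ℓ1ₓ} ∪ Icc Smin Smax`. [this work] -/
def Sx : Finset ℕ := Skelφ.Prm.SxOf (Mu O) (ℓ1 κ Φ p O 0) (Smin κ Φ p O) (Smax κ Φ p O)

/-- The `y`-extent list `{M_u+1, ℓ1_y} ∪ Icc Smin Smax`. [this work] -/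
def Sy : Finset ℕ := Skelφ.Prm.SxOf (Mu O) (ℓ1 κ Φ p O 1) (Smin κ Φ p O) (Smax κ Φ p O)

/-! ## §2 The running density: excess radius, fibre block, schedule -/

/-- The excess radius at `q` (planar diameter `60 rmax`, uniform over centres). [this work] -/
def Rex (q : unitInterval) : ℕ → ℕ := Skelφ.excessRadiusAtK Φ.frame Φ.degree_le (60 * (cells κ Φ p O).rmax) (η κ Φ) q

/-- The largest planar scale used: `max Smax (max (Gb Smax) (Fb Smax))`. [this work] -/
def topScale : ℕ := max (Smax κ Φ p O) (max (O.D.Gb (Smax κ Φ p O)) (O.D.Fb (Smax κ Φ p O)))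

/-- **The seed-depth slot** `ψMz := max (ψ M) ρz` (statement-identical to `Sgn.ψMz` of `SkelSign1Params1`; repeated here so that this file depends
on the landed part 5 only). [this work] -/
def ψMz : ℕ := max (O.D.R (M O)) (ρz O)

/-- The inputs of the fibre block at `q` (the `ψM` slot is `ψMz`). [this work] -/
def schedIn (q : unitInterval) : Skelφ.Prm.SchedIn :=
  ⟨(cells κ Φ p O).rmax, topScale κ Φ p O, M O, ψMz O, O.D.R (topScale κ Φ p O), reachK Φ O, Rex κ Φ p O q⟩

/-- **The radius schedule at `q`**: `Skelφ.Prm.sched (schedIn q) cells = concRadii2S cells gap 0 E₀ L′`. [this work] -/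
def Λ (q : unitInterval) : ConcRadiiG := Skelφ.Prm.sched (schedIn κ Φ p O q) (cells κ Φ p O)

end OLevel

/-! ## §3 The bundle -/

section Bundle

variable (κ : Consts) {V : Type} [DecidableEq V] [Countable V] {G : SimpleGraph V} [G.LocallyFinite] (Φ : PlanarSkeletonSign G)
  (t : V) (p : unitInterval) (hC : Φ.CylSubcritical p)

/-- **The unit existential from the 8th fact** at the corrected floor. [folklore] -/
theorem exists_unitSpec {O : Skelφ.StepI.Out V} (hk : m₀ κ ≤ O.D.k) (htwo : Skelφ.StepI.TwoUnitL O.D) :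
    ∃ ex ey, Skelφ.Prm.UnitSpec O.D 8 (A κ) (L κ) (n₀ κ Φ p O) ex ey :=
  htwo 8 (A κ) (L κ) (n₀ κ Φ p O) (by norm_num) (L_hyps κ).1 (le_trans (le_max_right _ _) hk) (L_hyps κ).2

/-- Under the 8th fact: `n₀ ≤ e i` (so `Sgn.n₀ ≤ e i` AND `ρz ≤ e i`) and `D.k ≤ e i`. [folklore] -/
theorem n₀_le_e {O : Skelφ.StepI.Out V} (hk : m₀ κ ≤ O.D.k) (htwo : Skelφ.StepI.TwoUnitL O.D) (i : Fin 2) :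
    n₀ κ Φ p O ≤ e κ Φ p O i ∧ O.D.k ≤ e κ Φ p O i :=
  Skelφ.Prm.le_eOf (exists_unitSpec κ Φ p hk htwo) i

/-- **Admissibility of the lists** under the facts and the 8th fact. [folklore] -/
theorem S_adm (O : Skelφ.StepI.Out V) (hF : O.Facts Φ.frame hC (m₀ κ)) (htwo : Skelφ.StepI.TwoUnitL O.D) :
    (∀ M' ∈ Sz O, O.M₀ ≤ M') ∧ (∀ ℓ ∈ Sx κ Φ p O, O.n₁ ≤ ℓ) ∧ (∀ ℓ ∈ Sy κ Φ p O, O.n₁ ≤ ℓ) := by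
  have hn : O.n₁ ≤ Mu O + 1 := (Skelφ.Prm.n₁_le_Mu O.M₀ O.n₁).trans (Nat.le_succ _)
  have h0 := (n₀_le_e κ Φ p hF.1 htwo 0).1
  have h1 := (n₀_le_e κ Φ p hF.1 htwo 1).1
  unfold n₀ Sgn.n₀ at h0 h1
  have e0 : Mu O + 1 ≤ ℓ1 κ Φ p O 0 := by unfold ℓ1; omega
  have e1 : Mu O + 1 ≤ ℓ1 κ Φ p O 1 := by unfold ℓ1; omega
  have f0 : Mu O + 1 ≤ Smin κ Φ p O := by
    unfold Smin emin
    rcases le_total (e κ Φ p O 0) (e κ Φ p O 1) with h | h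
    · rw [min_eq_left h]; omega
    · rw [min_eq_right h]; omega
  exact ⟨Skelφ.Prm.SzOf_adm (Skelφ.Prm.M₀_le_Mu O.M₀ O.n₁), Skelφ.Prm.SxOf_adm hn e0 f0, Skelφ.Prm.SxOf_adm hn e1 f0⟩

/-- **THE CONCRETE CHOICES at a centred one-type `(κ, Φ, t, p, hC)`, corrected floor and seed-depth slot.** [this work] -/
def choiceAt : Choice κ Φ t p hC where
  δI := δI κ Φ
  m₀ := m₀ κ
  Sz := fun O => Sz O
  Sx := fun O => Sx κ Φ p O
  Sy := fun O => Sy κ Φ p O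
  P := fun O => cells κ Φ p O
  Λ := fun O q => Λ κ Φ p O q
  δI_pos := Skelφ.Prm.δI_pos G Φ.degree_le κ (A κ)
  S_adm := fun O hF _ htwo => S_adm κ Φ p hC O hF htwo

end Bundle

end Sgn₂

/-! ## §4 The choice function of record and its well-formedness -/

/-- **THE CONCRETE CHOICE FUNCTION OF RECORD of the single-type D″ node**: `Sgn₂.choiceAt`. [cite: KozmaNitzan2024, §4 Theorem 6 (pp. 25–31)] -/
def signChoice₂ : ChoiceFn :=
  fun κ _ _ _ _ _ Φ _ t _ _ _ p _ _ hC => Sgn₂.choiceAt κ Φ t p hC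

/-- `signChoice₂` unfolds to `Sgn₂.choiceAt` (by `rfl`). [folklore] -/
theorem signChoice₂_eq (κ : SkelConc.Consts) {V : Type} [DecidableEq V] [Countable V] (G : SimpleGraph V) [G.LocallyFinite]
    (Φ : PlanarSkeletonSign G) (hg : ¬ Literature.Barriers.CriticalPhenomena.HasExponentialGrowth G) (t : V) (ht : t ∈ Φ.types)
    (h1 : Φ.types = {t}) (h0 : Φ.φ t = 0) (p : unitInterval) (hp0 : 0 < (p : ℝ)) (hp1 : (p : ℝ) < 1) (hC : Φ.CylSubcritical p) :
    signChoice₂ κ G Φ hg t ht h1 h0 p hp0 hp1 hC = Sgn₂.choiceAt κ Φ t p hC := rfl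

/-- **The choices of record are well formed**: `WFS2 P (Λ O q)` (`Skelφ.Prm.sched_WFS2`) and `K₀ ≤ K = Kof K₀`. [this work] -/
theorem wfHoldsFn_signChoice₂ : WFHoldsFn signChoice₂ := by
  intro κ V _ _ G _ Φ hg t ht h1 h0 p hp0 hp1 hC O q _
  exact ⟨Skelφ.Prm.sched_WFS2 _ _, BoxProdZ2.le_Kof κ.K₀⟩

end PlanarSkeletonSign

end Summit.CriticalPhenomena.PercolationContinuityZ3.Theorems.Transplant

end
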